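import Summits.BirchSwinnertonDyer.Rank1Residual.ManinAdditive.NeronFLineDepth
import HarnessLib
import HarnessLib.Audit.Tags

/-!
# THE ATKIN–LEHNER SIGN OF A CONGRUENCE: the **eigenspace / two-cusp** reformulation of the AL-cut congruence law
# (E-desc-26′ `ALCutCongruenceLaw`, E-desc-67 `ALEigenspaceCongruenceLaw`), the **same-sign fusion law** (E-desc-70
# `ALSameSignFusionLaw`), the print-derivable support E-desc-69a `ALSignRigidityAwayFromP`, the support statement
# `ALCutIndexBetween`, and the PROVED lattice sandwich S-desc-g11 — cell `bsd-f2-manin` (D-0131 (3) frontier: the Manin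
# constant at additive primes), lens desc (descent / visibility: congruence modules vs modular degree), planner desc g11
# MEMO-desc §28; typed by the cell typer g14 (T-desc-15, 2026-08-28T18:40:24Z) VERBATIM from HOME/desc/g11/Sketch-desc-g11.lean
# sha16 2f7cc73a4ddcb5e0 (farm rc 0 · 0/0/0), namespace `DescG11` ↦ `…ManinAdditive.ALSignCongruence`.

HONEST FRAMING.  The three `@[conjecture]` rows are E-blind / optimal-datum LAWS, nothing asserted; `ALSignRigidityAwayFromP` is
PRINT-DERIVABLE (Atkin–Lehner–Li local signs + [Deligne 1973 Antwerp II, Thm. 6.5(c)] — desc: «NOT a law of this cell»), left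
untagged as a support input like E-desc-28♯; `ALCutIndexBetween` is a THEOREM-CANDIDATE support statement (index monotonicity
along `S^{AL} ⊆ L_{Q_p} ⊆ S`, statement only).  BC5 witness (desc g11 MEMO-desc §28.8; MS-0/eig engine `eig_ms.py`
4dd4eecfe1d9da94, rows HOME/desc/g11/EIGMS-rows-g11.tsv e1ddb37f6875b904; D-desc-6 PARI census; SIGNPAIRS-1500.txt): E-desc-67
826/826 odd additive incidences (310 levels, 1263 optimal curves), E-desc-26′ 826/826 odd + 681/681 dyadic, sandwich 0 violations,
NON-VACUOUS (`ord_p r_S > ord_p deg φ`) at 291/291; E-desc-70 512/512 same-sign pairs (225/225 at `v_p ≥ 2`); cross-sign 335/335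
flip exactly at `p`; the dyadic eigenspace version was KILLED in-seat (11/27, then 202/681) — hence `p ≠ 2` in E-desc-67.
NOT in print at `p² ∣ N` (nearest print BY NAME: [AgasheRibetStein2012, Thm. 2.1, Prop. 2.3] at `p ∤ N` / `p ∥ N`; Yazdani 2011
L. 2.3–2.5; Yoo (square-free); Ling 1993, acq-09664 open).  REF1 R-desc-16 (audit §28.3 (i)–(iii), BC7 vs stmt-22967/22968,
placement, novelty grade) PENDING at filing — a finding is repaired under a NEW name (append-only).  Why novel (desc): the excess of
the congruence number over the modular degree at an additive prime is carried EXACTLY by the cross-sign congruences.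
bears_on: stmt-BirchSwinnertonDyer-22967 (`--supports` refused for ManinAdditive targets).  PARTITION 0 / ladder-live ·
beyond-print theorem: no (laws) · BSD is not proved by this; Manin's conjecture is not proved by this.

desc g11 VERBATIM:

Nothing here is a route item; `@[conjecture]` defs assert nothing.  Tree declarations only
(`integralCuspForms0`, `atkinLehnerInvolutionAt`, `lineIndex`, `alStableLattice`, `ModularParametrizationData`,
`cuspCoeff`, `periodLattice`).  Hypothesis grammar copied VERBATIM from `ALStableCongruenceLaw` (leaf
`NeronFLineDepth`).  Census witnesses: HOME/desc/g11/EIGCONG-rows-g11.tsv, HOME/desc/g11/SIGNPAIRS-1500.txt,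
HOME/data (D-desc-6, 263/263).  MEMO-desc §28.
-/

noncomputable section

open scoped MatrixGroups ModularForm

open CongruenceSubgroup WeierstrassCurve Literature.NumberTheory.EllipticCurves.ModularForms
  Literature.NumberTheory.DiophantineGeometry

namespace Summit.BirchSwinnertonDyer.Rank1Residual.ManinAdditive.ALSignCongruence

/-! ### Abstract lattice sandwich for an involution (PROVED) -/

section Abstract

variable {R V P : Type*} [CommRing R] [AddCommGroup V] [Module R V] [AddCommGroup P] [Module R P]

/-- For a submodule `S`, an endomorphism `w` and a scalar `ε`: the `ε`-eigen-sublattice `S ∩ ker (w − ε)` lies in the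
cut lattice `S ∩ w⁻¹ S`. -/
theorem inf_ker_le_inf_comap (S : Submodule R V) (w : V →ₗ[R] V) (ε : R) :
    S ⊓ LinearMap.ker (w - ε • LinearMap.id) ≤ S ⊓ S.comap w := by
  intro x hx
  rcases hx with ⟨hxS, hxk⟩
  refine ⟨hxS, ?_⟩
  have hk : w x - ε • x = 0 := by
    simpa [LinearMap.mem_ker, LinearMap.sub_apply, LinearMap.smul_apply] using hxk
  have hwx : w x = ε • x := sub_eq_zero.mp hk
  change w x ∈ S
  rw [hwx]
  exact S.smul_mem ε hxS

/-- **Sandwich, upper half.** If `w` is an involution (`w (w x) = x`), `ε² = 1`, and `lam` is a functional with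
`lam (w x) = ε • lam x` (e.g. the `e_f`-coordinate for a `w`-eigenform `f` of sign `ε`, `w` self-adjoint), then
`2 · lam (S ∩ w⁻¹ S) ⊆ lam (S ∩ ker (w − ε))`: with the trivial inclusion this gives
`[lam(S ∩ ker(w−ε)) : lam f] ∣ [lam(S ∩ w⁻¹S) : lam f] ∣ 2 · [lam(S ∩ ker(w−ε)) : lam f]` on the `f`-line. -/
theorem two_smul_mem_map_inf_ker (S : Submodule R V) (w : V →ₗ[R] V) (lam : V →ₗ[R] P) (ε : R)
    (hε : ε * ε = 1) (hw : ∀ x, w (w x) = x) (hlam : ∀ x, lam (w x) = ε • lam x)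
    {y : P} (hy : y ∈ (S ⊓ S.comap w).map lam) :
    (2 : R) • y ∈ (S ⊓ LinearMap.ker (w - ε • LinearMap.id)).map lam := by
  rcases hy with ⟨x, hx, rfl⟩
  have hxS : x ∈ S := hx.1
  have hwxS : w x ∈ S := hx.2
  refine ⟨x + ε • w x, ?_, ?_⟩
  · refine Submodule.mem_inf.mpr ⟨S.add_mem hxS (S.smul_mem ε hwxS), ?_⟩
    rw [LinearMap.mem_ker, LinearMap.sub_apply, LinearMap.smul_apply, LinearMap.id_apply, map_add,
      map_smul, hw, smul_add, smul_smul, hε, one_smul]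
    abel
  · rw [map_add, map_smul, hlam, smul_smul, hε, one_smul, two_smul]

end Abstract

/-! ### The two-cusp (AL-cut) lattice and the AL-eigen lattice at `p` (tree declarations only) -/

section Lattices

variable {N : ℕ} [NeZero N]

variable (N) in
/-- The **two-cusp / AL-cut lattice at `p`**: `L_{Q_p} := S ∩ w_{Q_p}⁻¹ S`, `S = S₂(Γ₀(N); ℤ)`, `Q_p = p^{v_p(N)}` — the forms
whose `q`-expansions are integral at `∞` AND at the cusp `w_{Q_p} ∞ = 1/(N/Q_p)` (by the `q`-expansion principle on the
smooth open of `X₀(N)_{ℤ_p}` through those two cusps this is `H⁰(X^∞ ∪ X^{w∞}, Ω¹)`; it contains `S^{AL}` and the Néron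
lattice).  Its `f`-line index is the per-involution AL congruence number `r_{Q_p}(f)` of MEMO-desc §21/§28. -/
def alCutLattice (p : ℕ) : Submodule ℤ (CuspForm (Gamma0 N) 2) :=
  integralCuspForms0 N 2 ⊓ (integralCuspForms0 N 2).comap ((atkinLehnerInvolutionAt N 2 p).restrictScalars ℤ)

variable (N) in
/-- The **AL-eigen lattice at `p` of sign `ε`**: `S^{ε} := S ∩ ker (w_{Q_p} − ε)`, the integral forms in the
`ε`-eigenspace of `w_{Q_p}` (for `ε = +1`: the integral forms on the quotient curve `X₀(N)/w_{Q_p}`).  Its `f`-line index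
`r^{ε}_p(f)` is the congruence number of `f` WITHIN its own Atkin–Lehner eigenspace at `p`. -/
def alEigenLattice (p : ℕ) (ε : ℤ) : Submodule ℤ (CuspForm (Gamma0 N) 2) :=
  integralCuspForms0 N 2 ⊓
    LinearMap.ker ((atkinLehnerInvolutionAt N 2 p).restrictScalars ℤ - ε • LinearMap.id)

/-- `S^{ε} ⊆ L_{Q_p}` (PROVED; no hypothesis on `ε`). -/
theorem alEigenLattice_le_alCutLattice (p : ℕ) (ε : ℤ) : alEigenLattice N p ε ≤ alCutLattice N p :=
  inf_ker_le_inf_comap _ _ _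

/-- `L_{Q_p} ⊆ S` (PROVED). -/
theorem alCutLattice_le (p : ℕ) : alCutLattice N p ≤ integralCuspForms0 N 2 := inf_le_left

/-- `S^{AL} ⊆ L_{Q_p}` for every prime `p ∣ N` (PROVED: each member of the defining family of `alStableLattice` is
integral and `w_{Q_p}`-stable). -/
theorem alStableLattice_le_alCutLattice {p : ℕ} (hp : p.Prime) (hpN : p ∣ N) :
    alStableLattice N ≤ alCutLattice N p := by
  apply sSup_le
  intro M hM
  rcases hM with ⟨hMS, hMw⟩
  intro x hx
  refine ⟨hMS hx, ?_⟩
  change (atkinLehnerInvolutionAt N 2 p).restrictScalars ℤ x ∈ integralCuspForms0 N 2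
  exact hMS (hMw p hp hpN ⟨x, hx, rfl⟩)

/-- **Sandwich on the lattices (PROVED modulo the two printed facts taken as hypotheses).**  If `w_{Q_p}` is an involution
on `S₂(Γ₀(N))` and `lam` is a `ℤ`-linear functional with `lam ∘ w_{Q_p} = ε · lam`, `ε = ±1` (the `e_f`-coordinate for
a newform `f` with `w_{Q_p} f = ε f`, by self-adjointness of `w_{Q_p}`), then `2 · lam(L_{Q_p}) ⊆ lam(S^{ε})`; with
`S^{ε} ⊆ L_{Q_p}`: `r^{ε}_p ∣ r_{Q_p} ∣ 2 r^{ε}_p`, so `ord_ℓ r^{ε}_p = ord_ℓ r_{Q_p}` for every odd `ℓ`. -/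
theorem two_smul_mem_map_alEigenLattice {P : Type*} [AddCommGroup P] (p : ℕ) (ε : ℤ)
    (hε : ε * ε = 1) (hw : ∀ x, atkinLehnerInvolutionAt N 2 p (atkinLehnerInvolutionAt N 2 p x) = x)
    (lam : CuspForm (Gamma0 N) 2 →ₗ[ℤ] P) (hlam : ∀ x, lam (atkinLehnerInvolutionAt N 2 p x) = ε • lam x)
    {y : P} (hy : y ∈ (alCutLattice N p).map lam) : (2 : ℤ) • y ∈ (alEigenLattice N p ε).map lam :=
  two_smul_mem_map_inf_ker (R := ℤ) (integralCuspForms0 N 2) ((atkinLehnerInvolutionAt N 2 p).restrictScalars ℤ)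
    lam ε hε hw hlam hy

end Lattices

/-! ### Candidates (nothing asserted) -/

/-- **Candidate E-desc-26′ `ALCutCongruenceLaw` (per-involution form of E-desc-26; desc g4/g11).**  For the
`X₀(N)`-optimal curve and every prime `p` with `p² ∣ N`: `ord_p [e_f L_{Q_p} : ℤ f] = ord_p deg φ` — the single
Atkin–Lehner involution at `p` already cuts the whole Agashe–Ribet–Stein excess `ord_p(r_E/m_E)`.
Census: D-desc-6 (PARI, all newform orbits, every `N ≤ 300` with `p² ∣ N`: 263/263 incidences `ord_p r_AL = ord_p m_E`,
and `r_AL = r_{Q_p}` on the `f`-line at single-additive-prime levels) + in-seat 46/46 classes (EIGCONG-rows-g11.tsv,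
`ord_p r_{Q_p} = ord_p m` at all 19 odd and 27 dyadic additive incidences).  Not in print (ARS 2012 Thm. 2.1 is the
`p ∤ N` / `p ∥ N` shadow).
TYPER FRAMING: lens desc; BC5 826/826 odd + 681/681 dyadic incidences (EIGMS-rows-g11 e1ddb37f6875b904) + D-desc-6 263/263; REF1
R-desc-16 PENDING.  OPEN.
[cite: AgasheRibetStein2012, Thm. 2.1 (shape only: congruence number vs modular degree at `p ∤ N` / `p ∥ N`; the AL-cut law at `p² ∣ N` is the cell's E-desc-26′ — desc MEMO-desc §28)] -/
@[conjecture]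
def ALCutCongruenceLaw : Prop :=
  ∀ (W : WeierstrassCurve ℚ) [W.IsElliptic] [W.IsGloballyMinimal] [NeZero (W.conductorNorm ℤ)]
    (D : ModularParametrizationData W (W.conductorNorm ℤ)),
    (∀ z ∈ D.L.lattice, ∃ w ∈ periodLattice D.f, z = D.c * w) →
    (∀ (W' : WeierstrassCurve ℚ) [W'.IsElliptic]
        (D' : ModularParametrizationData W' (W.conductorNorm ℤ)),
        D'.f = D.f → D.modularDegree ≤ D'.modularDegree) →
    ∀ p : ℕ, p.Prime → p ^ 2 ∣ W.conductorNorm ℤ →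
      padicValNat p (lineIndex (alCutLattice (W.conductorNorm ℤ) p) D.f) = padicValNat p D.modularDegree

/-- **Candidate E-desc-67 `ALEigenspaceCongruenceLaw` (desc g11; ODD `p` only).**  For the `X₀(N)`-optimal curve, an odd
prime `p` with `p² ∣ N` and the sign `ε = ε_p(f)`: the congruence number of `f` WITHIN ITS OWN `w_{Q_p}`-EIGENSPACE has
the same `p`-part as the modular degree, `ord_p [e_f S^{ε} : ℤ f] = ord_p deg φ`.  Equivalently the ARS excess
`ord_p(r_E/m_E)` is exactly the depth of the CROSS-SIGN congruences of `f` (those needing the `−ε`-eigenspace).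
Equivalent to E-desc-26′ at odd `p` by the proved sandwich; census 19/19 odd additive incidences (EIGCONG-rows-g11.tsv) and,
via the sandwich, D-desc-6.  FALSE AT `p = 2` (11/27 dyadic incidences have `ord₂ r^{ε} = ord₂ deg φ − 1`:
56a1, 80a1, 96a1, 112a1, 112c1, 120a1, 128a1, 192b1, 240b1, 240c1, 240d1), where the two-cusp lattice is the right object.
TYPER FRAMING: lens desc; BC5 826/826 odd additive incidences, non-vacuous 291/291 (EIGMS-rows-g11); REF1 R-desc-16 PENDING.
OPEN.
[cite: AgasheRibetStein2012, Prop. 2.3 (shape only; the eigenspace congruence law is the cell's E-desc-67 — desc MEMO-desc §28)] -/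
@[conjecture]
def ALEigenspaceCongruenceLaw : Prop :=
  ∀ (W : WeierstrassCurve ℚ) [W.IsElliptic] [W.IsGloballyMinimal] [NeZero (W.conductorNorm ℤ)]
    (D : ModularParametrizationData W (W.conductorNorm ℤ)),
    (∀ z ∈ D.L.lattice, ∃ w ∈ periodLattice D.f, z = D.c * w) →
    (∀ (W' : WeierstrassCurve ℚ) [W'.IsElliptic]
        (D' : ModularParametrizationData W' (W.conductorNorm ℤ)),
        D'.f = D.f → D.modularDegree ≤ D'.modularDegree) →
    ∀ p : ℕ, p.Prime → p ≠ 2 → p ^ 2 ∣ W.conductorNorm ℤ →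
    ∀ ε : ℤ, (ε = 1 ∨ ε = -1) →
      atkinLehnerInvolutionAt (W.conductorNorm ℤ) 2 p D.f = (ε : ℂ) • D.f →
      padicValNat p (lineIndex (alEigenLattice (W.conductorNorm ℤ) p ε) D.f) = padicValNat p D.modularDegree

/-- **Candidate E-desc-70 `ALSameSignFusionLaw` (desc g11; the prediction of "Atkin–Lehner-refined multiplicity one").**
Two non-isogenous elliptic curves `E₁, E₂` of the same conductor `N`, an odd prime `p` with `p² ∣ N`, `f₁ ≡ f₂ (mod p)`
away from `N` (all `a_ℓ`, `ℓ ∤ N` prime), equal `U_q`-eigenvalues at the primes `q ∥ N`, and the SAME Atkin–Lehner sign at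
`p`: then `p` divides BOTH modular degrees (the two copies of `ρ̄` in `J₀(N)[𝔪]` lie in the same `w_{Q_p}`-eigen-piece and
fuse).  With opposite signs at `p` nothing is claimed — there the copies sit in `J^{+}` and `J^{−}`, which meet inside
`J₀(N)[2]`, so multiplicity one FAILS at `𝔪` (ARS 2012 Prop. 2.3's irreducible example 99A1 is of this kind: 99a1 ≡ 99b1 ≡
99d1 (mod 3), `w₉ = +1, −1, −1`).  Census (SIGNPAIRS-1500.txt, optimal curves `N ≤ 1500`, single additive prime): same-sign
congruent pairs at `v_p(N) ≥ 2`: 108/108 with `p ∣ deg φ₁` and `p ∣ deg φ₂` (plus 229/229 at `v_p(N) ≤ 1`, the classical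
multiplicity-one range); cross-sign pairs 157, all flipping exactly at `p`.  Not in print at `p² ∣ N`.
TYPER FRAMING: lens desc; BC5 512/512 same-sign congruent pairs `N ≤ 1500` (225/225 at `v_p ≥ 2`; SIGNPAIRS-1500.txt); REF1
R-desc-16 PENDING.  OPEN.
[cite: AgasheRibetStein2012, Prop. 2.3 (shape only: the cross-sign example 99A1; the same-sign fusion law is the cell's E-desc-70 — desc MEMO-desc §28)] -/
@[conjecture]
def ALSameSignFusionLaw : Prop :=
  ∀ (W₁ W₂ : WeierstrassCurve ℚ) [W₁.IsElliptic] [W₂.IsElliptic] [NeZero (W₁.conductorNorm ℤ)]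
    (D₁ : ModularParametrizationData W₁ (W₁.conductorNorm ℤ))
    (D₂ : ModularParametrizationData W₂ (W₁.conductorNorm ℤ)),
    W₂.conductorNorm ℤ = W₁.conductorNorm ℤ → D₁.f ≠ D₂.f →
    ∀ p : ℕ, p.Prime → p ≠ 2 → p ^ 2 ∣ W₁.conductorNorm ℤ →
    (∀ ℓ : ℕ, ℓ.Prime → ¬ ℓ ∣ W₁.conductorNorm ℤ →
        ∃ z : ℤ, (z : ℂ) = cuspCoeff D₁.f ℓ - cuspCoeff D₂.f ℓ ∧ (p : ℤ) ∣ z) →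
    (∀ q : ℕ, q.Prime → q ∣ W₁.conductorNorm ℤ → ¬ q ^ 2 ∣ W₁.conductorNorm ℤ →
        cuspCoeff D₁.f q = cuspCoeff D₂.f q) →
    (∃ ε : ℂ, atkinLehnerInvolutionAt (W₁.conductorNorm ℤ) 2 p D₁.f = ε • D₁.f ∧
        atkinLehnerInvolutionAt (W₁.conductorNorm ℤ) 2 p D₂.f = ε • D₂.f) →
    p ∣ D₁.modularDegree ∧ p ∣ D₂.modularDegree

/-- **KILLED AS TYPED (misstated) — refuter-1 §R80 (R-desc-16, 2026-08-28T19:08:43Z): 54a1 vs 54b1 (`N = 54`, `p = 3`,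
`q = 2 ∥ N`) satisfy every hypothesis below (both carry a rational `3`-torsion point, so `a_ℓ ≡ 1 + ℓ (mod 3)` for all
`ℓ ≥ 5`) yet `w₂ = +1 / −1`: the typing DROPPED desc's census clause «equal `a_q` at the primes `q ∥ N`» (present in E-desc-70).
SUPERSEDED by `ALSignRigidityAwayFromPR` (appended below, the clause restored = REF1's repair C′); this body is kept only because
landed declarations are immutable (append-only rule) — do NOT use it as an input.**
Original docstring: **E-desc-69a `ALSignRigidityAwayFromP` (print-derivable, NOT a conjecture of this cell: AL sign = local root
number (Atkin–Lehner–Li) + Deligne 1973, Antwerp II, Thm 6.5(c): `ε₀ mod 𝔪` depends only on `σ mod 𝔪`, residue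
characteristic `p ≠ q`; `p` odd separates `±1`).** Two elliptic newforms of the same level, congruent mod an odd prime `p`
away from the level, have the SAME Atkin–Lehner sign at every prime `q ≠ p` of the level. Census desc g11
SIGNPAIRS2-1500: all 335 cross-sign congruent optimal pairs `N ≤ 1500` flip exactly at `q = p` (178 of them at levels with a
second additive prime available). Filed as the support edge that makes "cross-sign" mean "cross-sign AT `p`". -/
def ALSignRigidityAwayFromP : Prop :=
  ∀ (W₁ W₂ : WeierstrassCurve ℚ) [W₁.IsElliptic] [W₂.IsElliptic] [NeZero (W₁.conductorNorm ℤ)]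
    (D₁ : ModularParametrizationData W₁ (W₁.conductorNorm ℤ))
    (D₂ : ModularParametrizationData W₂ (W₁.conductorNorm ℤ)),
    W₂.conductorNorm ℤ = W₁.conductorNorm ℤ →
    ∀ p : ℕ, p.Prime → p ≠ 2 →
    (∀ ℓ : ℕ, ℓ.Prime → ¬ ℓ ∣ W₁.conductorNorm ℤ →
        ∃ z : ℤ, (z : ℂ) = cuspCoeff D₁.f ℓ - cuspCoeff D₂.f ℓ ∧ (p : ℤ) ∣ z) →
    ∀ q : ℕ, q.Prime → q ∣ W₁.conductorNorm ℤ → q ≠ p →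
    ∃ ε : ℂ, atkinLehnerInvolutionAt (W₁.conductorNorm ℤ) 2 q D₁.f = ε • D₁.f ∧
        atkinLehnerInvolutionAt (W₁.conductorNorm ℤ) 2 q D₂.f = ε • D₂.f

/-! ### Proved edges -/

/-- **E-desc-26 ⟹ divisibility half of E-desc-26′**: since `S^{AL} ⊆ L_{Q_p} ⊆ S`, the AL-stable law gives
`[e_f S^{AL} : ℤ f] = deg φ`; the cut index lies between (index monotonicity is left to the typer — statement only). -/
def ALCutIndexBetween : Prop :=
  ∀ {N : ℕ} [NeZero N] (f : CuspForm (Gamma0 N) 2) (p : ℕ), p.Prime → p ∣ N →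
    lineIndex (alStableLattice N) f ∣ lineIndex (alCutLattice N p) f ∧
      lineIndex (alCutLattice N p) f ∣ lineIndex (integralCuspForms0 N 2) f

/-! ### Repair C′ of E-desc-69a (refuter-1 §R80; appended by the cell typer g14, 2026-08-28T19:1xZ) -/

/-- **E-desc-69a (repaired) `ALSignRigidityAwayFromPR`** — `ALSignRigidityAwayFromP` with desc's census clause «equal `a_q` at
every `q ∥ N`» RESTORED (VERBATIM the clause of E-desc-70 `ALSameSignFusionLaw`, l.208–209 of the desc g11 sketch; = refuter-1
§R80 repair C′): two elliptic newforms of the same level `N`, congruent mod an odd prime `p` at all `ℓ ∤ N` AND with equal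
`U_q`-eigenvalues at the primes `q ∥ N`, have the SAME Atkin–Lehner sign at every prime `q ≠ p` of the level.  PRINT-DERIVABLE
for all pairs incl. reducible `ρ̄` (AL sign = local root number [AtkinLehner1970] + [Deligne 1973 Antwerp II, Thm. 6.5(c)]:
`ε̄₀` lives on the Grothendieck group, READ p. 56–57 by refuter-1), hence left untagged like the original (a support input, not a
law of this cell); survives REF1's twist attacks (§R80); census desc g11 SIGNPAIRS2-1500: 335/335 cross-sign congruent optimal pairs
`N ≤ 1500` flip exactly at `q = p`.  No impact on E-desc-26′/67/70.
[cite: AtkinLehner1970, Thm. 3 (shape only: `w_q`-eigenvalues of newforms = local signs; the rigidity-under-congruence statement is print-derivable via Deligne 1973 Thm. 6.5(c) — desc MEMO-desc §28.4(a), refuter-1 §R80 C′)] -/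
def ALSignRigidityAwayFromPR : Prop :=
  ∀ (W₁ W₂ : WeierstrassCurve ℚ) [W₁.IsElliptic] [W₂.IsElliptic] [NeZero (W₁.conductorNorm ℤ)]
    (D₁ : ModularParametrizationData W₁ (W₁.conductorNorm ℤ))
    (D₂ : ModularParametrizationData W₂ (W₁.conductorNorm ℤ)),
    W₂.conductorNorm ℤ = W₁.conductorNorm ℤ →
    ∀ p : ℕ, p.Prime → p ≠ 2 →
    (∀ ℓ : ℕ, ℓ.Prime → ¬ ℓ ∣ W₁.conductorNorm ℤ →
        ∃ z : ℤ, (z : ℂ) = cuspCoeff D₁.f ℓ - cuspCoeff D₂.f ℓ ∧ (p : ℤ) ∣ z) →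
    (∀ q : ℕ, q.Prime → q ∣ W₁.conductorNorm ℤ → ¬ q ^ 2 ∣ W₁.conductorNorm ℤ →
        cuspCoeff D₁.f q = cuspCoeff D₂.f q) →
    ∀ q : ℕ, q.Prime → q ∣ W₁.conductorNorm ℤ → q ≠ p →
    ∃ ε : ℂ, atkinLehnerInvolutionAt (W₁.conductorNorm ℤ) 2 q D₁.f = ε • D₁.f ∧
        atkinLehnerInvolutionAt (W₁.conductorNorm ℤ) 2 q D₂.f = ε • D₂.f

/-- The killed typing implies the repaired one (it merely lacks a hypothesis) — recorded so that nothing downstream can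
confuse the direction of the repair. (typer edge, PROVED.) -/
theorem alSignRigidityAwayFromPR_of_awayFromP (h : ALSignRigidityAwayFromP) : ALSignRigidityAwayFromPR :=
  fun W₁ W₂ _ _ _ D₁ D₂ hN p hp hp2 hcong _ q hq hqN hqp ↦ h W₁ W₂ D₁ D₂ hN p hp hp2 hcong q hq hqN hqp

end Summit.BirchSwinnertonDyer.Rank1Residual.ManinAdditive.ALSignCongruence

end
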